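import Literature.Probability.Process.PlanarBrownianVec
import Literature.Probability.Process.PathHittingEvents
import Literature.Probability.RandomPlanarGeometry.BrownianLoopMeasure
import Mathlib.Probability.Distributions.Gaussian.IsGaussianProcess.Independence
import HarnessLib

/-!
# The Brownian bridge is independent of the endpoint; transfer of bridge events to Brownian events

Proof file (theorems only). The planar Brownian bridge of the loop-measure file is
`b_s = Z_s − s Z_1` (`BrownianLoop.unitBridge`, here read at real times `s ≤ 1`:
`Z_s(ω) − s • Z_1(ω)`, `Z = BrownianLoop.planarBrownian` on `(WienerPair, wienerPair)`). We prove: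

* `indepFun_realBridge_endpoint` — for the canonical real Brownian motion `B`, the bridge process
  `(B_{s∧1} − (s∧1) B_1)_s` is independent of `B_1` (both are linear images of the Gaussian process
  `B`, and `Cov(B_{s} − s B_1, B_1) = s − s = 0` for `s ≤ 1`; Mathlib
  `IsGaussianProcess.indepFun_of_covariance_eq_zero`), and `indepFun_bridgePair_endpoints` — the
  same for the pair of coordinates under `wienerPair` (`Process.indepFun_prodMap`);
* `measure_bridge_event_le_mul_inter_small` — **transfer**: for a closed `A`, an open `O`, `i ≤ 1`
  and `0 < η ≤ 1`, the probability that the bridge from `w` visits `A` by time `i` and avoids `O`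
  up to time `1` is at most `7/η²` times the probability of the same event intersected with
  `{|B¹_1| ≤ η, |B²_1| ≤ η}` (independence, and `P(|B¹_1| ≤ η, |B²_1| ≤ η) ≥ η²/7`,
  `Process.gaussVec_two_one_closedBall_ge`). On the latter event the Brownian path `w + Z` is
  uniformly `2η`-close to the bridge path `w + b` on `[0, 1]`, which converts bridge events into
  Brownian events with slightly modified sets (done by the consumer).

No definition and no named fact is introduced.

## References

* D. Revuz, M. Yor, *Continuous Martingales and Brownian Motion* (1999), Ch. I, Ex. (3.10)
  (the Brownian bridge `B_s − s B_1` is independent of `B_1`). [folklore]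
-/

noncomputable section

open MeasureTheory ProbabilityTheory Filter Set Metric Complex
open scoped NNReal ENNReal Topology

namespace Literature.Probability.RandomPlanarGeometry

open Literature.Probability.Process
open BrownianLoop (planarBrownian)

/-! ### Independence of the bridge from the endpoint -/

/-- **The real Brownian bridge is independent of the endpoint**: under the pre-Wiener measure the
process `s ↦ B_{s∧1} − (s∧1) B_1` is independent of `B_1`. [folklore] -/
theorem indepFun_realBridge_endpoint :
    IndepFun (fun (ω₁ : ℝ≥0 → ℝ) (s : ℝ≥0) ↦ brownian (min s 1) ω₁ - ((min s 1 : ℝ≥0) : ℝ) * brownian 1 ω₁)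
      (fun (ω₁ : ℝ≥0 → ℝ) (_ : Unit) ↦ brownian 1 ω₁) preWienerMeasure := by
  have hB := RandomPlanarGeometry.isPreBrownianReal_brownian
  haveI := RandomPlanarGeometry.isProbabilityMeasure_preWienerMeasure'
  have hmem : ∀ t, MemLp (brownian t) 2 preWienerMeasure := fun t ↦
    (hB.isGaussianProcess.hasGaussianLaw_eval t).memLp_two
  apply IsGaussianProcess.indepFun_of_covariance_eq_zero
    (X := fun (s : ℝ≥0) (ω₁ : ℝ≥0 → ℝ) ↦ brownian (min s 1) ω₁ - ((min s 1 : ℝ≥0) : ℝ) * brownian 1 ω₁)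
    (Y := fun (_ : Unit) (ω₁ : ℝ≥0 → ℝ) ↦ brownian 1 ω₁)
  · -- jointly Gaussian: linear images of the Gaussian process `B`
    classical
    apply hB.isGaussianProcess.of_isGaussianProcess
    rintro (s | u)
    · refine ⟨{min s 1, 1},
        { toFun := fun x ↦ x ⟨min s 1, by simp⟩ - ((min s 1 : ℝ≥0) : ℝ) * x ⟨1, by simp⟩
          map_add' := fun x y ↦ by simp; ring
          map_smul' := fun c x ↦ by simp; ring }, fun ω ↦ by simp⟩
    · refine ⟨{1},
        { toFun := fun x ↦ x ⟨1, by simp⟩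
          map_add' := fun x y ↦ by simp
          map_smul' := fun c x ↦ by simp }, fun ω ↦ by simp⟩
  · intro s
    exact ((measurable_brownian _).sub ((measurable_brownian 1).const_mul _)).aemeasurable
  · intro _
    exact (measurable_brownian 1).aemeasurable
  · intro s _
    rw [covariance_fun_sub_left (hmem _) ((hmem 1).const_mul _) (hmem 1), covariance_const_mul_left,
      hB.covariance_eval, hB.covariance_eval]
    simp

/-- The bridge-process map of one raw path is measurable. [folklore] -/
theorem measurable_realBridgePath :
    Measurable fun (ω₁ : ℝ≥0 → ℝ) (s : ℝ≥0) ↦ brownian (min s 1) ω₁ - ((min s 1 : ℝ≥0) : ℝ) * brownian 1 ω₁ :=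
  measurable_pi_lambda _ fun _ ↦ (measurable_brownian _).sub ((measurable_brownian 1).const_mul _)

/-- The endpoint map of one raw path is measurable. [folklore] -/
theorem measurable_endpointPath : Measurable fun (ω₁ : ℝ≥0 → ℝ) (_ : Unit) ↦ brownian 1 ω₁ :=
  measurable_pi_lambda _ fun _ ↦ measurable_brownian 1

/-- **The pair of Brownian bridges is independent of the pair of endpoints** under `wienerPair`.
[folklore] -/
theorem indepFun_bridgePair_endpoints :
    IndepFun (Prod.map (fun (ω₁ : ℝ≥0 → ℝ) (s : ℝ≥0) ↦ brownian (min s 1) ω₁ - ((min s 1 : ℝ≥0) : ℝ) * brownian 1 ω₁)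
        (fun (ω₁ : ℝ≥0 → ℝ) (s : ℝ≥0) ↦ brownian (min s 1) ω₁ - ((min s 1 : ℝ≥0) : ℝ) * brownian 1 ω₁))
      (Prod.map (fun (ω₁ : ℝ≥0 → ℝ) (_ : Unit) ↦ brownian 1 ω₁) (fun (ω₁ : ℝ≥0 → ℝ) (_ : Unit) ↦ brownian 1 ω₁))
      wienerPair := by
  haveI := RandomPlanarGeometry.isProbabilityMeasure_preWienerMeasure'
  rw [wienerPair]
  exact indepFun_prodMap indepFun_realBridge_endpoint indepFun_realBridge_endpoint measurable_realBridgePath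
    measurable_endpointPath measurable_realBridgePath measurable_endpointPath

/-! ### Transfer of bridge events -/

/-- The bridge pair read in `ℂ`: at time `s` the image of `ω` is `Z_{s∧1}(ω) − (s∧1) • Z_1(ω)`.
[folklore] -/
theorem toC_bridgePair (ω : WienerPair) (s : ℝ≥0) :
    ((brownian (min s 1) ω.1 - ((min s 1 : ℝ≥0) : ℝ) * brownian 1 ω.1 : ℝ) : ℂ) +
        ((brownian (min s 1) ω.2 - ((min s 1 : ℝ≥0) : ℝ) * brownian 1 ω.2 : ℝ) : ℂ) * I =
      planarBrownian (min s 1) ω - ((min s 1 : ℝ≥0) : ℝ) • planarBrownian 1 ω := by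
  simp only [BrownianLoop.planarBrownian, real_smul]
  push_cast
  ring

/-- `P(|B¹_1| ≤ η, |B²_1| ≤ η) ≥ η²/7` for `0 ≤ η ≤ 1`. [folklore] -/
theorem measure_endpoints_small_ge {η : ℝ} (hη0 : 0 ≤ η) (hη1 : η ≤ 1) :
    ENNReal.ofReal (η ^ 2 / 7) ≤ wienerPair {ω | |brownian 1 ω.1| ≤ η ∧ |brownian 1 ω.2| ≤ η} := by
  have hset : {ω : WienerPair | |brownian 1 ω.1| ≤ η ∧ |brownian 1 ω.2| ≤ η} =
      (fun ω : WienerPair ↦ (![brownian 1 ω.1, brownian 1 ω.2] : Fin 2 → ℝ)) ⁻¹' closedBall 0 η := by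
    ext ω
    simp only [mem_setOf_eq, mem_preimage, mem_closedBall, dist_zero_right,
      pi_norm_le_iff_of_nonneg hη0, Fin.forall_fin_two, Real.norm_eq_abs]
    simp
  rw [hset, ← Measure.map_apply (measurable_planar 1) measurableSet_closedBall, map_planar 1]
  exact gaussVec_two_one_closedBall_ge hη0 hη1

/-- **Transfer of bridge events.** For `A` closed, `O` open, `i ≤ 1` and `0 < η ≤ 1`:

  `P( (∃ s ≤ i, w + b_s ∈ A) ∧ ∀ s ≤ 1, w + b_s ∉ O )`
    `≤ (7/η²) · P( ((∃ s ≤ i, w + b_s ∈ A) ∧ ∀ s ≤ 1, w + b_s ∉ O) ∧ |B¹_1| ≤ η ∧ |B²_1| ≤ η )`,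

`b_s = Z_s − s • Z_1` the planar bridge (independence of the bridge from `Z_1`). [folklore] -/
theorem measure_bridge_event_le_mul_inter_small (w : ℂ) {A : Set ℂ} (hA : IsClosed A) {O : Set ℂ}
    (hO : IsOpen O) {i : ℝ≥0} (hi : i ≤ 1) {η : ℝ} (hη0 : 0 < η) (hη1 : η ≤ 1) :
    wienerPair {ω | (∃ s ≤ i, w + (planarBrownian s ω - (s : ℝ) • planarBrownian 1 ω) ∈ A) ∧
        ∀ s ≤ 1, w + (planarBrownian s ω - (s : ℝ) • planarBrownian 1 ω) ∉ O} ≤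
      ENNReal.ofReal (7 / η ^ 2) *
        wienerPair ({ω | (∃ s ≤ i, w + (planarBrownian s ω - (s : ℝ) • planarBrownian 1 ω) ∈ A) ∧
            ∀ s ≤ 1, w + (planarBrownian s ω - (s : ℝ) • planarBrownian 1 ω) ∉ O} ∩
          {ω | |brownian 1 ω.1| ≤ η ∧ |brownian 1 ω.2| ≤ η}) := by
  -- the bridge-pair and endpoint maps
  set pX : (ℝ≥0 → ℝ) → (ℝ≥0 → ℝ) := fun ω₁ s ↦ brownian (min s 1) ω₁ - ((min s 1 : ℝ≥0) : ℝ) * brownian 1 ω₁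
    with hpX
  set pe : (ℝ≥0 → ℝ) → (Unit → ℝ) := fun ω₁ _ ↦ brownian 1 ω₁ with hpe
  have hind : IndepFun (Prod.map pX pX) (Prod.map pe pe) wienerPair := indepFun_bridgePair_endpoints
  -- the event as a preimage of a measurable set of raw pairs
  set Φ : ℝ≥0 → WienerPair → ℂ := fun s p ↦ w + ((p.1 s : ℂ) + (p.2 s : ℂ) * I) with hΦ
  have hΦm : ∀ s, Measurable (Φ s) := fun s ↦ by
    simp only [hΦ]; fun_prop
  obtain ⟨S₁, hS₁, hS₁iff⟩ := exists_measurableSet_iff_exists_mem Φ hΦm hA 0 i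
  obtain ⟨S₂, hS₂, hS₂iff⟩ := exists_measurableSet_iff_forall_notMem Φ hΦm hO 1
  have hcont : ∀ ω : WienerPair, Continuous fun s ↦ Φ s (Prod.map pX pX ω) := fun ω ↦ by
    simp only [hΦ, hpX, Prod.map]
    have hm : Continuous fun s : ℝ≥0 ↦ min s 1 := continuous_id.min continuous_const
    have h1 : Continuous fun s : ℝ≥0 ↦ brownian (min s 1) ω.1 := (continuous_brownian ω.1).comp hm
    have h2 : Continuous fun s : ℝ≥0 ↦ brownian (min s 1) ω.2 := (continuous_brownian ω.2).comp hm
    have hc : Continuous fun s : ℝ≥0 ↦ ((min s 1 : ℝ≥0) : ℝ) := NNReal.continuous_coe.comp hm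
    fun_prop
  have hΦval : ∀ (ω : WienerPair) (s : ℝ≥0), Φ s (Prod.map pX pX ω) =
      w + (planarBrownian (min s 1) ω - ((min s 1 : ℝ≥0) : ℝ) • planarBrownian 1 ω) := fun ω s ↦ by
    simp only [hΦ, hpX, Prod.map]
    rw [toC_bridgePair]
  set Ev : Set WienerPair := {ω | (∃ s ≤ i, w + (planarBrownian s ω - (s : ℝ) • planarBrownian 1 ω) ∈ A) ∧
      ∀ s ≤ 1, w + (planarBrownian s ω - (s : ℝ) • planarBrownian 1 ω) ∉ O} with hEv
  have hEvpre : Ev = Prod.map pX pX ⁻¹' (S₁ ∩ S₂) := by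
    ext ω
    simp only [hEv, mem_setOf_eq, mem_preimage, mem_inter_iff]
    rw [hS₁iff _ (hcont ω), hS₂iff _ (hcont ω)]
    simp only [hΦval]
    constructor
    · rintro ⟨⟨s, hsi, hs⟩, havoid⟩
      refine ⟨⟨s, bot_le, hsi, ?_⟩, fun s hs1 ↦ ?_⟩
      · rwa [min_eq_left (hsi.trans hi)]
      · rw [min_eq_left hs1]; exact havoid s hs1
    · rintro ⟨⟨s, -, hsi, hs⟩, havoid⟩
      refine ⟨⟨s, hsi, ?_⟩, fun s hs1 ↦ ?_⟩
      · rwa [min_eq_left (hsi.trans hi)] at hs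
      · have := havoid s hs1; rwa [min_eq_left hs1] at this
  -- the smallness event as a preimage
  set T : Set ((Unit → ℝ) × (Unit → ℝ)) := {q | |q.1 ()| ≤ η ∧ |q.2 ()| ≤ η} with hT
  have hTm : MeasurableSet T := by
    simp only [hT]
    exact (measurableSet_le ((measurable_pi_apply ()).comp measurable_fst).abs measurable_const).inter
      (measurableSet_le ((measurable_pi_apply ()).comp measurable_snd).abs measurable_const)
  have hsmall : {ω : WienerPair | |brownian 1 ω.1| ≤ η ∧ |brownian 1 ω.2| ≤ η} = Prod.map pe pe ⁻¹' T := by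
    ext ω; simp [hT, hpe]
  -- independence
  have hprod := hind.measure_inter_preimage_eq_mul _ _ (hS₁.inter hS₂) hTm
  rw [← hEvpre, ← hsmall] at hprod
  -- `P(small) ≥ η²/7`
  have hsm := measure_endpoints_small_ge hη0.le hη1
  -- algebra in `ℝ≥0∞`
  rw [hprod]
  calc wienerPair Ev = ENNReal.ofReal (7 / η ^ 2) * (wienerPair Ev * ENNReal.ofReal (η ^ 2 / 7)) := by
        rw [mul_comm (wienerPair Ev), ← mul_assoc, ← ENNReal.ofReal_mul (by positivity),
          show 7 / η ^ 2 * (η ^ 2 / 7) = 1 by field_simp, ENNReal.ofReal_one, one_mul]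
    _ ≤ ENNReal.ofReal (7 / η ^ 2) * (wienerPair Ev *
          wienerPair {ω | |brownian 1 ω.1| ≤ η ∧ |brownian 1 ω.2| ≤ η}) := by
        gcongr

end Literature.Probability.RandomPlanarGeometry

end
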